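import Summits.BirchSwinnertonDyer.BirchSwinnertonDyer.Theorems.AdditiveBranchIMCGordTwoRankOneVisibilityCert
import Literature.NumberTheory.EllipticCurves.MazurRubin2015.KummerImageGoodReduction
import HarnessLib

/-!
# Crux `GordTwoRankOne` (item 19358): the rank-ONE two-witness visibility door, HYBRID certificate shape —
# per place and per witness: (a) a `p`-th root in `E'(K_v)`, OR (i) `v ∤ p ∧ E'(K_v)[p] = 0`, OR
# (c) the local conditions AGREE along `θ` at `v` (`ι_v(θ) = 1`) — cell-free, NO named fact in the door

Cell `bsd-addord`, seat `bsd-addord-k1-c3` (D-0074 row B2), gen 8; sequel of `…GordTwoRankOneVisibility.lean` (§1–§3)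
and `…GordTwoRankOneVisibilityCert.lean` (§4) of gen 7. HONEST FRAMING: nothing here proves the Birch–Swinnerton-Dyer
conjecture or the crux (OPEN at class level on 19497/19498/19499); THEOREMS ONLY (no definition, no named fact, no
`sorry`); per-pair inputs are displayed binders decided OUTSIDE this file; nothing is booked by this file.

## Why a third shape

Gen 7's witness search (kit j263588) left 8 of the 12 content-window keys of the cell without a record: at a
multiplicative place `w ≠ 3` with `#E'(ℚ_w)[3] = 3` options (a)/(i) cost one dimension of `E'(ℚ)/3` per place and
per witness, and the two-dimensional GOOD subspace the door needs did not exist (`344214h`, `359442g`, `469755i`,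
`487278e`, `492624bf`: good dimension `0`–`1`). The tree, however, has COMPARISON theorems making such places FREE:
the local Kummer conditions of `E` and `E'` AGREE along `θ` (`ι_v(θ) = 1`, i.e. `θ_* 𝓢_v(E') ≤ 𝓢_v(E)`) at a place
where both curves are split multiplicative with `#E(K_v)[p] ≤ p` (kind (ii),
`relIndex_map_selmerLocalKer_eq_one_of_hasSplitMultiplicativeReductionAt`, Tate uniformisation — PROVED in the
tree, `TateCurve.Silverman1994_thmV53_tateUniformisation_holds`), where both are multiplicative of the same
`γ`-class with `μ_p(K_v) = 1` (kind (iii), `…_of_hasMultiplicativeReductionAt`,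
`Silverman1994_thmV53_corV54_tateUniformisation_holds`), at `v ∣ p` where both are `χ_d`-twists of curves good
at `p` (kind (vi), Mazur–Rubin 2015, named fact `hMRt`), … — with DECIDABLE numerals for (ii)/(iii) over `ℚ`
(team n1011's `DivisionDecider.relIndex_eq_one_of_kind{II,III}_checks_of_intModel`). At an agreeing place the
transported Kummer class of ANY rational point of `E'` satisfies `E`'s condition (Kummer classes are Selmer
everywhere, `kummerMapTorsion_mem_selmerLocalKer`), so NO condition on the witnesses remains there. This file
states the two-witness door with the agreement itself as the third per-place option — the door carries NO
comparison fact; each record supplies `ι_v(θ) = 1` at its agreeing places from the decider / fact it needs.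
With the freed places gen 7's own stage-3 tables give good dimension `2` for `344214h1 ← 344214a1`
(kinds (iii)@2, (ii)@13), `359442g1 ← 179721j1` ((vi)@3, (ii)@19, (ii)@1051), `487278e1 ← 487278bm1`
((vi)@3, (iii)@11, (iii)@107), `90459m1 ← 3933b1` ((vi)@3) — records to follow.

* §5a `exists_sha_ne_zero_of_congr_of_two_witnesses_hybrid` (any number field `K`, odd `p`).
* §5b `exists_sha_ne_zero_rankOne_irr_of_twoWitnesses_hybrid`, `missingLowerBoundAt_rankOne_irr_of_twoWitnesses_hybrid`
  (over `ℚ`; binders `hCT hGZK` only).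
* §5c `relIndex_eq_one_of_twistModels_above` — the kind-(vi) agreement over `ℚ` in the `ι_v(θ) = 1` currency
  from `hMRt` and two twist models (the shape k1-c2's companion records display: `C • V^{(d)} = W`, `C' • V'^{(d)} = W'`,
  `V`, `V'` good at `p`).

References: Cremona–Mazur 2000 §3 [CremonaMazur2000]; Agashe–Stein 2002 Lemma 3.6 [AgasheStein2002];
Mazur–Rubin 2015 Thm. 3.1 [MazurRubin2015SelmerCompanions]; Silverman ATAEC V.3.1, V.5.2–5.4 [SilvermanATAEC1994];
Silverman AEC X.4.14 [SilvermanAEC2009]; Gross 1991 §2 [GrossLMS1991].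
-/

set_option autoImplicit false

noncomputable section

open scoped Classical

open WeierstrassCurve Literature.NumberTheory.EllipticCurves
  Literature.NumberTheory.EllipticCurves.Rank1Residual
  Literature.NumberTheory.EllipticCurves.Rank1Residual.Typed
  Literature.NumberTheory.EllipticCurves.MazurRubin2015
  Literature.NumberTheory.GaloisRepresentations
  Summit.BirchSwinnertonDyer.Rank1Residual.GaloisImage
open NumberField IsDedekindDomain Rat.HeightOneSpectrum Field

set_option linter.dupNamespace false

namespace Summit.BirchSwinnertonDyer.BirchSwinnertonDyer.Theorems.AdditiveBranchIMCGordTwoRankOneVisibility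

/-! ## §5a The hybrid certificate shape: (a) / (i) / agreement — any number field -/

section HybridShape

variable {K : Type} [Field K] [NumberField K] (W W' : WeierstrassCurve K) [W.IsElliptic]
  [W'.IsElliptic] {p : ℕ} [hp : Fact p.Prime]

/-- **Two-witness visibility, HYBRID certificate shape (any number field `K`, odd `p`).** As
`exists_sha_ne_zero_of_congr_of_two_witnesses`, the local condition of `E` at each `v ∈ S` being supplied, for
EACH witness `P_i`, by EITHER (a) a `p`-th root of `P_i` in `E'(K_v)`, OR (i) `v ∤ p` and `E'(K_v)[p] = 0`, OR
(c) AGREEMENT of the local conditions along `θ` at `v`: `ι_v(θ) = 1`, i.e.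
`(𝓢_v E).relIndex (θ_* 𝓢_v E') = 1` (then the Kummer class of ANY point of `E'(K)`, Selmer for `E'` at `v`,
transports into `𝓢_v(E)` — `VisibleWitness.h1Equiv_kummerMapTorsion_mem_selmerLocalKer_of_relIndex_eq_one`).
Option (c) is witness-independent and is how the tree's comparison theorems enter (split/split, same
`γ`-class multiplicative, twists of good curves above `p`, both good above `p`, …); the door itself carries no
comparison fact. [cite: CremonaMazur2000, §3] [cite: AgasheStein2002, Lemma 3.6] -/
theorem exists_sha_ne_zero_of_congr_of_two_witnesses_hybrid (hp2 : p ≠ 2)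
    (θ : geomTorsion W' (p : ℤ) ≃+ geomTorsion W (p : ℤ))
    (hθ : ∀ (σ : absoluteGaloisGroup K) (P : geomTorsion W' (p : ℤ)), θ (σ • P) = σ • θ P)
    (S : Finset (HeightOneSpectrum (𝓞 K)))
    (hS : ∀ v : HeightOneSpectrum (𝓞 K), v ∉ S →
      W.HasGoodReductionAt v ∧ W'.HasGoodReductionAt v ∧ (p : 𝓞 K) ∉ v.asIdeal)
    (hE : ∃ G : W.toAffine.Point, ∀ Q : W.toAffine.Point,
      ∃ (a : ℤ) (R : W.toAffine.Point), Q = a • G + (p : ℤ) • R)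
    (P₁ P₂ : W'.toAffine.Point)
    (hind : ∀ a b : ℤ, a • P₁ + b • P₂ ∈
      (zsmulAddGroupHom (p : ℤ) : W'.toAffine.Point →+ W'.toAffine.Point).range →
      (p : ℤ) ∣ a ∧ (p : ℤ) ∣ b)
    (hdiv : ∀ P ∈ [P₁, P₂], ∀ v ∈ S,
      (∃ Q : (W'.baseChange (v.adicCompletion K)).toAffine.Point,
        p • Q = WeierstrassCurve.Affine.Point.baseChange (W' := W') K (v.adicCompletion K) P) ∨
      ((p : 𝓞 K) ∉ v.asIdeal ∧ Nat.card (nsmulAddMonoidHom p :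
        (W'.baseChange (v.adicCompletion K)).toAffine.Point →+ _).ker = 1) ∨
      ((selmerLocalKer W (v.adicCompletion K) (p : ℤ)).relIndex
        ((selmerLocalKer W' (v.adicCompletion K) (p : ℤ)).map (h1Equiv θ hθ).toAddMonoidHom) = 1)) :
    ∃ c : W.sha, c ≠ 0 ∧ p • c = 0 := by
  have hpp : p.Prime := Fact.out
  have hn : (p : ℤ) ≠ 0 := by exact_mod_cast hpp.ne_zero
  have hdiv' : ∀ P : geomPoints W', ∃ Q : geomPoints W', (p : ℤ) • Q = P :=
    W'.zsmul_geomPoints_surjective_holds hn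
  -- per-place dispatch: (a) / (i) as in §4, (c) by agreement
  have hloc : ∀ P ∈ [P₁, P₂], ∀ v ∈ S, h1Equiv θ hθ (kummerMapTorsion W' (p : ℤ) hdiv' P) ∈
      selmerLocalKer W (v.adicCompletion K) (p : ℤ) := by
    intro P hP v hv
    rcases hdiv P hP v hv with ⟨Q, hQ⟩ | ⟨hpv, hcard⟩ | hrel
    · exact VisibleWitness.h1Equiv_kummerMapTorsion_mem_selmerLocalKer_of_exists_smul_eq W W' θ hθ
        (v.adicCompletion K) hn hdiv' P ⟨Q, by rw [natCast_zsmul]; exact hQ⟩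
    · refine VisibleWitness.h1Equiv_kummerMapTorsion_mem_selmerLocalKer_of_natCard_eq_one W W' θ hθ
        (v.adicCompletion K) hdiv' P ?_
      rw [W'.natCard_kummerLocalConditionAt_adicCompletion v hpp.ne_zero, hcard, one_mul,
        natCard_quot_adicCompletionIntegers_eq_one hpv]
    · exact VisibleWitness.h1Equiv_kummerMapTorsion_mem_selmerLocalKer_of_relIndex_eq_one W W' θ hθ
        (v.adicCompletion K) hdiv' P hrel
  exact exists_sha_ne_zero_of_congr_of_two_witnesses W W' hp2 θ hθ S hS hdiv' hE P₁ P₂ hind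
    (hloc P₁ (by simp)) (hloc P₂ (by simp))

end HybridShape

/-! ## §5b The cell-free doors over `ℚ` (binders `hCT hGZK` only) -/

section HybridDoors

variable {W : WeierstrassCurve ℚ} [W.IsElliptic] [W.IsGloballyMinimal] {p : ℕ} [hp : Fact p.Prime]

omit [W.IsGloballyMinimal] in
/-- **`Ш(E)[p] ≠ 0` by two-witness visibility, HYBRID certificate shape** (`E/ℚ` of analytic rank one with
`E[p]` irreducible, `p` odd): GZK + irreducibility give the cyclicity of `E(ℚ)/pE(ℚ)`
(`exists_generator_rankOne_of_irr`); the per-pair data are `θ`, `S`, two witnesses independent mod `p`, and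
at each place of `S`, for each witness: (a) a `p`-th root in `E'(ℚ_w)`, or (i) `w ≠ p ∧ E'(ℚ_w)[p] = 0`, or
(c) `ι_w(θ) = 1`. NO twist model, NO comparison fact in the door. Per pair.
[cite: CremonaMazur2000, §3] [cite: AgasheStein2002, Lemma 3.6] -/
theorem exists_sha_ne_zero_rankOne_irr_of_twoWitnesses_hybrid
    (hGZK : rank_eq_analyticRank_of_analyticRank_le_one) (hp2 : p ≠ 2)
    (hirr : Irr W p) (hr : W.analyticRank = 1)
    (W' : WeierstrassCurve ℚ) [W'.IsElliptic]
    (θ : geomTorsion W' (p : ℤ) ≃+ geomTorsion W (p : ℤ))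
    (hθ : ∀ (σ : absoluteGaloisGroup ℚ) (P : geomTorsion W' (p : ℤ)), θ (σ • P) = σ • θ P)
    (S : Finset (HeightOneSpectrum (𝓞 ℚ)))
    (hS : ∀ w : HeightOneSpectrum (𝓞 ℚ), w ∉ S →
      W.HasGoodReductionAt w ∧ W'.HasGoodReductionAt w ∧ (p : 𝓞 ℚ) ∉ w.asIdeal)
    (P₁ P₂ : W'.toAffine.Point)
    (hind : ∀ a b : ℤ, a • P₁ + b • P₂ ∈
      (zsmulAddGroupHom (p : ℤ) : W'.toAffine.Point →+ W'.toAffine.Point).range →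
      (p : ℤ) ∣ a ∧ (p : ℤ) ∣ b)
    (hdiv : ∀ P ∈ [P₁, P₂], ∀ w ∈ S,
      (∃ Q : (W'.baseChange (w.adicCompletion ℚ)).toAffine.Point,
        p • Q = WeierstrassCurve.Affine.Point.baseChange (W' := W') ℚ (w.adicCompletion ℚ) P) ∨
      ((p : 𝓞 ℚ) ∉ w.asIdeal ∧ Nat.card (nsmulAddMonoidHom p :
        (W'.baseChange (w.adicCompletion ℚ)).toAffine.Point →+ _).ker = 1) ∨
      ((selmerLocalKer W (w.adicCompletion ℚ) (p : ℤ)).relIndex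
        ((selmerLocalKer W' (w.adicCompletion ℚ) (p : ℤ)).map (h1Equiv θ hθ).toAddMonoidHom) = 1)) :
    ∃ c : W.sha, c ≠ 0 ∧ p • c = 0 := by
  obtain ⟨G, hG⟩ := exists_generator_rankOne_of_irr (W := W) (p := p) hGZK hirr hr
  -- §5a is stated with the classical `DecidableEq`; transport pointwise with `convert`
  refine exists_sha_ne_zero_of_congr_of_two_witnesses_hybrid W W' hp2 θ hθ S hS
    ⟨G, fun Q ↦ ?_⟩ P₁ P₂ (fun a b hab ↦ hind a b (by convert hab)) hdiv
  obtain ⟨a, R, h⟩ := hG Q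
  exact ⟨a, R, by convert h⟩

omit [W.IsGloballyMinimal] in
/-- **The LOWER half by two-witness visibility, HYBRID certificate shape: the CONTENT-window door for ANY
rank-one row with `E[p]` irreducible** (`p` odd; datum `#Ш(E)_an = q`, `ord_p q ≤ 2`). Published inputs:
Cassels–Tate (`hCT`), GZK (`hGZK`). Per-pair data: `θ`, `S`, two witnesses of the partner independent mod `p`
with, at every place of `S`, option (a) / kind (i) / agreement `ι_w(θ) = 1`. Chain: visibility ⟹ `Ш(E)[p] ≠ 0`
⟹ Cassels–Tate squareness ⟹ `ord_p #Ш_an ≤ 2 ≤ ord_p #Ш`. Serves the rank-one content rows of 19358 (and of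
19359 / 19360, any cell). Per pair; NOT a class theorem. [cite: CremonaMazur2000, §3] [cite: AgasheStein2002, Lemma 3.6]
[cite: SilvermanAEC2009, Thm. X.4.14] -/
theorem missingLowerBoundAt_rankOne_irr_of_twoWitnesses_hybrid
    (hCT : exists_casselsTate_pairing (K := ℚ)) (hGZK : rank_eq_analyticRank_of_analyticRank_le_one)
    (hp2 : p ≠ 2) (hirr : Irr W p) (hr : W.analyticRank = 1)
    {q : ℚ} (hq : shaAn W = (q : ℂ)) (hv : padicValRat p q ≤ 2)
    (W' : WeierstrassCurve ℚ) [W'.IsElliptic]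
    (θ : geomTorsion W' (p : ℤ) ≃+ geomTorsion W (p : ℤ))
    (hθ : ∀ (σ : absoluteGaloisGroup ℚ) (P : geomTorsion W' (p : ℤ)), θ (σ • P) = σ • θ P)
    (S : Finset (HeightOneSpectrum (𝓞 ℚ)))
    (hS : ∀ w : HeightOneSpectrum (𝓞 ℚ), w ∉ S →
      W.HasGoodReductionAt w ∧ W'.HasGoodReductionAt w ∧ (p : 𝓞 ℚ) ∉ w.asIdeal)
    (P₁ P₂ : W'.toAffine.Point)
    (hind : ∀ a b : ℤ, a • P₁ + b • P₂ ∈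
      (zsmulAddGroupHom (p : ℤ) : W'.toAffine.Point →+ W'.toAffine.Point).range →
      (p : ℤ) ∣ a ∧ (p : ℤ) ∣ b)
    (hdiv : ∀ P ∈ [P₁, P₂], ∀ w ∈ S,
      (∃ Q : (W'.baseChange (w.adicCompletion ℚ)).toAffine.Point,
        p • Q = WeierstrassCurve.Affine.Point.baseChange (W' := W') ℚ (w.adicCompletion ℚ) P) ∨
      ((p : 𝓞 ℚ) ∉ w.asIdeal ∧ Nat.card (nsmulAddMonoidHom p :
        (W'.baseChange (w.adicCompletion ℚ)).toAffine.Point →+ _).ker = 1) ∨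
      ((selmerLocalKer W (w.adicCompletion ℚ) (p : ℤ)).relIndex
        ((selmerLocalKer W' (w.adicCompletion ℚ) (p : ℤ)).map (h1Equiv θ hθ).toAddMonoidHom) = 1)) :
    MissingLowerBoundAt W p := by
  have hex : ∃ c : W.sha, c ≠ 0 ∧ p • c = 0 :=
    exists_sha_ne_zero_rankOne_irr_of_twoWitnesses_hybrid hGZK hp2 hirr hr W' θ hθ S hS P₁ P₂ hind hdiv
  have hfinSha : W.ShaFinite := (hGZK W (by rw [hr])).2
  exact missingLowerBoundAt_of_casselsTate_of_pow_dvd W p hCT hfinSha hq (k := 1) (by simpa using hv)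
    (by simpa using dvd_shaOrder_of_exists_torsion W p hex)

end HybridDoors

/-! ## §5c Kind (vi) in the agreement currency: twists of good curves above `p` (Mazur–Rubin 2015, `hMRt`) -/

section KindVI

variable {W W' : WeierstrassCurve ℚ} [W.IsElliptic] [W'.IsElliptic] {p : ℕ} [hp : Fact p.Prime]

/-- **Kind (vi), `ι_v(θ) = 1` form.** For an odd prime `p`, twists `W = C • V^{(d)}`, `W' = C' • V'^{(d)}` (same
`d ≠ 0`) of curves `V`, `V'` with GOOD reduction at `p`, a `Γ_ℚ`-isomorphism `θ : W'[p] ⥲ W[p]` and the place `w` of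
`p`: `(𝓢_w W).relIndex (θ_* 𝓢_w W') = 1` — k1-c2's `selmerLocalKer_le_of_twist_of_hasGoodReductionAtPrime` read through
`relIndex_map_selmerLocalKer_eq_one_iff`; the third option of the hybrid door at `w ∣ p`. Conditional on the named
fact `hMRt` (Mazur–Rubin 2015 Thm. 3.1, twisted). [cite: MazurRubin2015SelmerCompanions, Thm. 3.1 and §6 proof Case 5 (twisted paragraph)] -/
theorem relIndex_eq_one_of_twistModels_above
    (hMRt : selmerLocalKer_iff_of_twist_of_goodReduction_above) (hp2 : p ≠ 2)
    (V V' : WeierstrassCurve ℚ) [V.IsElliptic] [V'.IsElliptic]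
    {d : ℚ} (C C' : VariableChange ℚ) (hd : d ≠ 0)
    (hW : C • V.quadraticTwist d = W) (hW' : C' • V'.quadraticTwist d = W')
    (hV : V.HasGoodReductionAtPrime p) (hV' : V'.HasGoodReductionAtPrime p)
    (θ : geomTorsion W' (p : ℤ) ≃+ geomTorsion W (p : ℤ))
    (hθ : ∀ (σ : absoluteGaloisGroup ℚ) (P : geomTorsion W' (p : ℤ)), θ (σ • P) = σ • θ P)
    (w : HeightOneSpectrum (𝓞 ℚ)) (hw : (p : 𝓞 ℚ) ∈ w.asIdeal) :
    (selmerLocalKer W (w.adicCompletion ℚ) (p : ℤ)).relIndex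
      ((selmerLocalKer W' (w.adicCompletion ℚ) (p : ℤ)).map (h1Equiv θ hθ).toAddMonoidHom) = 1 :=
  (relIndex_map_selmerLocalKer_eq_one_iff W W' θ hθ).mpr fun _ hc ↦
    AdditiveBranchIMCGordTwoRankZeroCompanion.selmerLocalKer_le_of_twist_of_hasGoodReductionAtPrime hMRt hp2
      V V' C C' hd hW hW' θ hθ w hw hV hV' hc

/-- **Kind (vi) at a place given by its prime** (`primesEquiv w = p`), the records' currency.
[cite: MazurRubin2015SelmerCompanions, Thm. 3.1 and §6 proof Case 5 (twisted paragraph)] -/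
theorem relIndex_eq_one_of_twistModels_of_primesEquiv
    (hMRt : selmerLocalKer_iff_of_twist_of_goodReduction_above) (hp2 : p ≠ 2)
    (V V' : WeierstrassCurve ℚ) [V.IsElliptic] [V'.IsElliptic]
    {d : ℚ} (C C' : VariableChange ℚ) (hd : d ≠ 0)
    (hW : C • V.quadraticTwist d = W) (hW' : C' • V'.quadraticTwist d = W')
    (hV : V.HasGoodReductionAtPrime p) (hV' : V'.HasGoodReductionAtPrime p)
    (θ : geomTorsion W' (p : ℤ) ≃+ geomTorsion W (p : ℤ))
    (hθ : ∀ (σ : absoluteGaloisGroup ℚ) (P : geomTorsion W' (p : ℤ)), θ (σ • P) = σ • θ P)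
    (w : HeightOneSpectrum (𝓞 ℚ)) (hw : (primesEquiv w : ℕ) = p) :
    (selmerLocalKer W (w.adicCompletion ℚ) (p : ℤ)).relIndex
      ((selmerLocalKer W' (w.adicCompletion ℚ) (p : ℤ)).map (h1Equiv θ hθ).toAddMonoidHom) = 1 := by
  refine relIndex_eq_one_of_twistModels_above hMRt hp2 V V' C C' hd hW hW' hV hV' θ hθ w ?_
  rw [← hw]
  exact natCast_natGenerator_mem w

end KindVI

/-! ## §5d Kind (v) in the agreement currency: BOTH curves good above `p` (Mazur–Rubin 2015, untwisted, `hMR`) -/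

section KindV

variable {W W' : WeierstrassCurve ℚ} [W.IsElliptic] [W'.IsElliptic] {p : ℕ} [hp : Fact p.Prime]

/-- **Kind (v), `ι_v(θ) = 1` form.** For an odd prime `p`, elliptic curves `W`, `W'` over `ℚ` BOTH with good
reduction at the place `w` of `p`, and a `Γ_ℚ`-isomorphism `θ : W'[p] ⥲ W[p]`: `(𝓢_w W).relIndex (θ_* 𝓢_w W') = 1` —
the tree's `selmerLocalKer_iff_of_goodReduction_above_rat` read through `relIndex_map_selmerLocalKer_eq_one_iff`; the third
option of the hybrid door at `w ∣ p` for pairs GOOD at `p` (gen 7's `…VisibilityGoodAbove` door is the special case).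
Conditional on the named fact `hMR` (Mazur–Rubin 2015 Thm. 3.1, untwisted).
[cite: MazurRubin2015SelmerCompanions, Thm. 3.1 (iv)(b) and §6 proof Case 5] -/
theorem relIndex_eq_one_of_goodReduction_of_primesEquiv
    (hMR : selmerLocalKer_iff_of_goodReduction_above) (hp2 : p ≠ 2)
    (θ : geomTorsion W' (p : ℤ) ≃+ geomTorsion W (p : ℤ))
    (hθ : ∀ (σ : absoluteGaloisGroup ℚ) (P : geomTorsion W' (p : ℤ)), θ (σ • P) = σ • θ P)
    (w : HeightOneSpectrum (𝓞 ℚ)) (hw : (primesEquiv w : ℕ) = p)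
    (hW : W.HasGoodReductionAt w) (hW' : W'.HasGoodReductionAt w) :
    (selmerLocalKer W (w.adicCompletion ℚ) (p : ℤ)).relIndex
      ((selmerLocalKer W' (w.adicCompletion ℚ) (p : ℤ)).map (h1Equiv θ hθ).toAddMonoidHom) = 1 := by
  have hwp : (p : 𝓞 ℚ) ∈ w.asIdeal := by rw [← hw]; exact natCast_natGenerator_mem w
  exact (relIndex_map_selmerLocalKer_eq_one_iff W W' θ hθ).mpr fun c hc ↦
    (selmerLocalKer_iff_of_goodReduction_above_rat hMR W W' hp2 θ hθ w hwp hW hW' c).mp hc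

end KindV

end Summit.BirchSwinnertonDyer.BirchSwinnertonDyer.Theorems.AdditiveBranchIMCGordTwoRankOneVisibility

end
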